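import Literature.AnabelianGeometry.AbsoluteAnabelian.AbsTopIII.Thm19KummerContainer
import HarnessLib

/-!
# [AbsTopIII] Thm. 1.9 (d): first lemmas on the Kummer container (proof-only companion)

Mochizuki, *Topics in Absolute Anabelian Geometry III*, §1, Thm. 1.9 (d) p. 37 (lit key
`paper:url-5493eb38cbb7`): "`lim_{→V} H¹(Π_V, μ_Ẑ(Π_U))`".  Proof-only companion of
`Thm19KummerContainer.lean` (cell abc-iut, sub-DAG `plan/L4/SUBDAG-AbsTopIII-Thm19.md`, row Thm19.d):
the direct-limit bookkeeping every discharger of `Thm19d_*` needs — compatibility of the structure maps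
with the transitions, exhaustion of the container by the levels, the Kummer map of a level in terms of
the structure map, and "`k̄_NF^× ⊆ K_{Z_NF}^×`" inside the container (by construction of the parts).
All declarations are theorems (Mathlib `AddCommGroup.DirectLimit` API); no anabelian content.
HONEST FRAMING: nothing here bears on [IUTchIII] Cor. 3.12.
-/

noncomputable section

open CategoryTheory
open scoped Classical

namespace Literature.AnabelianGeometry.AbsoluteAnabelian.AbsTopIII

universe u

namespace CurveModel.NFComplementSystem

variable {M : CurveModel.{u}} {Z : M.Curve} {ι : Type u} [Preorder ι] (S : NFComplementSystem M Z ι)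

/-- Compatibility of the structure maps `H¹(Π_{V_i}, M_Z) → lim` with the transitions (`i ≤ j`).
[cite: MochizukiAbsTopIII2015, Thm 1.9 (d) p.37] -/
theorem toContainer_transition {i j : ι} (h : i ≤ j) (η : S.H1 i) :
    S.toContainer j (S.transition i j h η) = S.toContainer i η :=
  AddCommGroup.DirectLimit.of_f (G := fun i => S.H1 i) (f := fun i j h => S.transition i j h)
    (hij := h) η

/-- Every element of `lim_{→V} H¹(Π_V, M_Z)` comes from some level (directed, nonempty index preorder).
[cite: MochizukiAbsTopIII2015, Thm 1.9 (d) p.37] -/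
theorem exists_toContainer [Nonempty ι] [IsDirectedOrder ι] (ξ : S.kummerContainer) :
    ∃ (i : ι) (η : S.H1 i), S.toContainer i η = ξ := by
  induction ξ using AddCommGroup.DirectLimit.induction_on with
  | ih i η => exact ⟨i, η, rfl⟩

/-- Vanishing in the limit is vanishing at some later level (exactness of `AddCommGroup.DirectLimit.of`
for a directed system). [cite: MochizukiAbsTopIII2015, Thm 1.9 (d) p.37] -/
theorem toContainer_eq_zero_iff [IsDirectedOrder ι]
    [DirectedSystem (fun i => S.H1 i) fun i j h => S.transition i j h] {i : ι} (η : S.H1 i) :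
    S.toContainer i η = 0 ↔ ∃ (j : ι) (h : i ≤ j), S.transition i j h η = 0 := by
  constructor
  · intro h0
    obtain ⟨j, hij, hj⟩ := AddCommGroup.DirectLimit.of.zero_exact (G := fun i => S.H1 i)
      (f := fun i j h => S.transition i j h) i η h0
    exact ⟨j, hij, hj⟩
  · rintro ⟨j, hij, hj⟩
    rw [← S.toContainer_transition hij, hj, map_zero]

end CurveModel.NFComplementSystem

namespace IntrinsicKummerModel

variable (M : IntrinsicKummerModel.{u}) {Z : M.Curve} {ι : Type u} [Preorder ι]
  (S : CurveModel.NFComplementSystem M.toCurveModel Z ι)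

/-- The Kummer map into the container is the level Kummer map followed by the structure map.
[cite: MochizukiAbsTopIII2015, Thm 1.9 (d) p.38] -/
theorem kummerToContainer_apply (i : ι) (f : Additive (M.regularUnits (S.V i))) :
    M.kummerToContainer S i f = S.toContainer i (M.kummerLevel S i f) :=
  rfl

/-- The level Kummer map is abc-iut-L4-t1's `κ_{V_i}` followed by the change of coefficients to `M_Z`.
[cite: MochizukiAbsTopIII2015, Thm 1.9 (d) p.38] -/
theorem kummerLevel_apply (i : ι) (f : Additive (M.regularUnits (S.V i))) :
    M.kummerLevel S i f = M.pushToZ S i (M.kummerAddHom (S.isOpen i) (S.isProper i) f) :=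
  rfl

/-- A class certified as an NF-constant (Prop. 1.8 (ii) criterion) is certified as lying in
"`K_{Z_NF}^×`". [cite: MochizukiAbsTopIII2015, Thm 1.9 (d) p.37] -/
theorem constantPart_subset_functionFieldPart : M.constantPart S ⊆ M.functionFieldPart S := by
  rintro ξ ⟨i, η, hη, rfl⟩
  exact ⟨i, η, Or.inr hη, rfl⟩

/-- Every element of "`K_{Z_NF}^×`" inside the container is the image of a class of `P_{V_i}` for some
level `i` ("via the subgroups of (c)"). [cite: MochizukiAbsTopIII2015, Thm 1.9 (d) p.38] -/
theorem exists_mem_PU_of_mem_functionFieldPart {ξ : S.kummerContainer} (hξ : ξ ∈ M.functionFieldPart S) :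
    ∃ (i : ι) (η : cyclotomeModH1 (M.res (S.isOpen i)) ZHatCoeff.{u}),
      η ∈ M.PU (S.isOpen i) (S.isProper i) ∧ S.toContainer i (M.pushToZ S i η) = ξ := by
  obtain ⟨i, η, hη, rfl⟩ := hξ
  rcases hη with hη | hη
  · exact ⟨i, η, hη.1, rfl⟩
  · exact ⟨i, η, hη.1, rfl⟩

end IntrinsicKummerModel

end Literature.AnabelianGeometry.AbsoluteAnabelian.AbsTopIII
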